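import Literature.Probability.Percolation.KozmaNitzanPreFKG
import HarnessLib

/-!
# `NoHeavyLowerTail` (stmt-CriticalPhenomena-4575) — the LOCALISED worst-relay row and the minor-monotonicity row
# (new-inequality factory, harness request P3-U12Q): corollaries of Kozma–Nitzan Lemma 3(i) with a compound upper family

Support file (prover `prim-ineq-prove-3`, factory PROOF seat #3; `--supports stmt-CriticalPhenomena-4575`).  No definitions, no sorries.

Setting: `μ = prodBernoulli w` on a finite vertex type, relays `a₁` (the WORSE: `μ(a₁ ↔ b) ≤ μ(a₂ ↔ b)`), `a₂`, sink `b`,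
observer `o`, and an ARBITRARY further vertex `s` (relay, Steiner vertex, anything — no hypothesis on it).

* `lemma3_i_tripod_compound`: `μ({o↔a₂} ∩ {s↔a₂} ∩ {a₁↔b} ∩ {a₁↮a₂}) ≤ μ({o↔a₂} ∩ {s↔a₂} ∩ {a₂↔b} ∩ {a₁↮a₂})` — the tree's
  `KozmaNitzan2024_lemma3_i_tripod` with the upper family `connFamily a₂ o ∩ connFamily a₂ s` in place of `connFamily a₂ o`.
* `localisedWorstRelayGluing_two` (harness row P3-U12Q, 0 / 269 362 dump instances before this proof):
  `μ({o↔a₂} ∩ {o↔s} ∩ {o↮b} ∩ {a₁↔b}) ≤ μ({o↔a₂} ∩ {o↔s} ∩ {o↔b} ∩ {a₁↮b})` — the two-relay worst-relay gluing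
  (`worstRelayGluing_card_le_two`) localised on `{o ↔ s}`.  (The localisations on `{o↮s}`, `{s↔b}`, `{s↮b}` are FALSE.)
* `minorMonotonicity_two` (row (MM_s) at k = 2): `μ({a₁↔b} ∩ {s↔o} ∩ {s↮b} ∩ {o↔a₂}) ≤ μ({s↔b} ∩ {a₁↮b} ∩ {a₁↮o})`, i.e. the
  two-relay event-gluing slack `μ(a₁↮b) − μ({o↔A} ∖ {o↔b})` does not increase when the vertex `s` is contracted into the worst relay
  `a₁` (pivotal form of `∂/∂w(a₁,s) ≤ 0`; seat census: the k-relay analogue has 0 / 246k + 2 812 adversarial climbs and is open).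
-/

noncomputable section

namespace Summit.CriticalPhenomena.PercolationContinuityZ3.Theorems

open MeasureTheory Set Literature.Probability.LatticeModels Literature.Probability.Percolation
open Literature.Probability.Percolation.KNPreFKG

variable {V : Type*} [Fintype V]

/-- **Kozma–Nitzan Lemma 3(i), tripod form with the compound upper family `{C_{a₂} ∋ o, s}`.**
If `μ(a₁ ↔ b) ≤ μ(a₂ ↔ b)` then `μ({o↔a₂}∩{s↔a₂}∩{a₁↔b}∩{a₁↮a₂}) ≤ μ({o↔a₂}∩{s↔a₂}∩{a₂↔b}∩{a₁↮a₂})`.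
[cite: KozmaNitzan2024, Lemma 3(i) (pp. 6–7) — corollary via `KozmaNitzan2024_lemma3_i`] -/
theorem lemma3_i_tripod_compound (w : Sym2 V → unitInterval) (a₁ a₂ b o s : V)
    (h : (prodBernoulli w).real (openConn a₁ b) ≤ (prodBernoulli w).real (openConn a₂ b)) :
    (prodBernoulli w).real (openConn o a₂ ∩ openConn s a₂ ∩ openConn a₁ b ∩ (openConn a₁ a₂)ᶜ) ≤
      (prodBernoulli w).real (openConn o a₂ ∩ openConn s a₂ ∩ openConn a₂ b ∩ (openConn a₁ a₂)ᶜ) := by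
  classical
  set μ := prodBernoulli w with hμ
  have hup : IsUpperSet (connFamily a₂ o ∩ connFamily a₂ s) :=
    (isUpperSet_connFamily a₂ o).inter (isUpperSet_connFamily a₂ s)
  have key := KozmaNitzan2024_lemma3_i w a₁ a₂ b le_rfl (by simpa using h) hup
  have hQ : {ω : BondConfig V | openEdgeCluster ω a₂ ∈ connFamily a₂ o ∩ connFamily a₂ s} =
      (openConn o a₂ ∩ openConn s a₂ : Set (BondConfig V)) := by
    have e1 := openConn_eq_setOf_connFamily (V := V) a₂ o
    have e2 := openConn_eq_setOf_connFamily (V := V) a₂ s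
    rw [openConn_symm o a₂, openConn_symm s a₂, e1, e2]
    ext ω; simp only [mem_setOf_eq, mem_inter_iff]
  rw [hQ, zero_mul, add_zero] at key
  -- remove the common part `{a₁ ↔ b} ∩ {a₂ ↔ b}`
  have hm : ∀ t : Set (BondConfig V), MeasurableSet t := fun _ => MeasurableSet.of_discrete
  have hsplit : ∀ x : V, μ.real (openConn x b ∩ (openConn o a₂ ∩ openConn s a₂)) =
      μ.real (openConn x b ∩ (openConn o a₂ ∩ openConn s a₂) ∩ (openConn a₁ b ∩ openConn a₂ b)) +
        μ.real ((openConn x b ∩ (openConn o a₂ ∩ openConn s a₂)) \ (openConn a₁ b ∩ openConn a₂ b)) := fun x =>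
    (measureReal_inter_add_sdiff (μ := μ) (s := openConn x b ∩ (openConn o a₂ ∩ openConn s a₂)) (hm _)).symm
  have hc : openConn a₁ b ∩ (openConn o a₂ ∩ openConn s a₂) ∩ (openConn a₁ b ∩ openConn a₂ b) =
      openConn a₂ b ∩ (openConn o a₂ ∩ openConn s a₂) ∩ (openConn a₁ b ∩ openConn a₂ b) := by
    ext ω; simp only [mem_inter_iff]; tauto
  have hd₁ : (openConn a₁ b ∩ (openConn o a₂ ∩ openConn s a₂)) \ (openConn a₁ b ∩ openConn a₂ b) =
      openConn o a₂ ∩ openConn s a₂ ∩ openConn a₁ b ∩ (openConn a₁ a₂)ᶜ := by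
    ext ω
    simp only [mem_sdiff, mem_inter_iff, mem_compl_iff, openConn, mem_setOf_eq, not_and]
    constructor
    · rintro ⟨⟨h1, h2, h3⟩, h4⟩
      exact ⟨⟨⟨h2, h3⟩, h1⟩, fun h12 => h4 h1 (h12.symm.trans h1)⟩
    · rintro ⟨⟨⟨h2, h3⟩, h1⟩, h4⟩
      exact ⟨⟨h1, h2, h3⟩, fun _ h2b => h4 (h1.trans h2b.symm)⟩
  have hd₂ : (openConn a₂ b ∩ (openConn o a₂ ∩ openConn s a₂)) \ (openConn a₁ b ∩ openConn a₂ b) =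
      openConn o a₂ ∩ openConn s a₂ ∩ openConn a₂ b ∩ (openConn a₁ a₂)ᶜ := by
    ext ω
    simp only [mem_sdiff, mem_inter_iff, mem_compl_iff, openConn, mem_setOf_eq, not_and]
    constructor
    · rintro ⟨⟨h1, h2, h3⟩, h4⟩
      exact ⟨⟨⟨h2, h3⟩, h1⟩, fun h12 => h4 (h12.trans h1) h1⟩
    · rintro ⟨⟨⟨h2, h3⟩, h1⟩, h4⟩
      exact ⟨⟨h1, h2, h3⟩, fun h1b _ => h4 (h1b.trans h1.symm)⟩
  rw [hsplit a₁, hsplit a₂, hc, hd₁, hd₂] at key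
  linarith

/-- **Localised two-relay worst-relay gluing** (harness row P3-U12Q): for the worse relay `a₁` (`μ(a₁↔b) ≤ μ(a₂↔b)`) and ANY
vertex `s`, `μ({o↔a₂}∩{o↔s}∩{o↮b}∩{a₁↔b}) ≤ μ({o↔a₂}∩{o↔s}∩{o↔b}∩{a₁↮b})`. [this file] -/
theorem localisedWorstRelayGluing_two (w : Sym2 V → unitInterval) (a₁ a₂ b o s : V)
    (h : (prodBernoulli w).real (openConn a₁ b) ≤ (prodBernoulli w).real (openConn a₂ b)) :
    (prodBernoulli w).real (openConn o a₂ ∩ openConn o s ∩ (openConn o b)ᶜ ∩ openConn a₁ b) ≤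
      (prodBernoulli w).real (openConn o a₂ ∩ openConn o s ∩ openConn o b ∩ (openConn a₁ b)ᶜ) := by
  have key := lemma3_i_tripod_compound w a₁ a₂ b o s h
  have e1 : (openConn o a₂ ∩ openConn o s ∩ (openConn o b)ᶜ ∩ openConn a₁ b : Set (BondConfig V)) =
      openConn o a₂ ∩ openConn s a₂ ∩ openConn a₁ b ∩ (openConn a₁ a₂)ᶜ := by
    ext ω
    simp only [mem_inter_iff, mem_compl_iff, openConn, mem_setOf_eq]
    constructor
    · rintro ⟨⟨⟨hoa, hos⟩, hob⟩, hab⟩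
      exact ⟨⟨⟨hoa, hos.symm.trans hoa⟩, hab⟩, fun h12 => hob (hoa.trans (h12.symm.trans hab))⟩
    · rintro ⟨⟨⟨hoa, hsa⟩, hab⟩, h12⟩
      exact ⟨⟨⟨hoa, hoa.trans hsa.symm⟩, fun hob => h12 (hab.trans (hob.symm.trans hoa))⟩, hab⟩
  have e2 : (openConn o a₂ ∩ openConn o s ∩ openConn o b ∩ (openConn a₁ b)ᶜ : Set (BondConfig V)) =
      openConn o a₂ ∩ openConn s a₂ ∩ openConn a₂ b ∩ (openConn a₁ a₂)ᶜ := by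
    ext ω
    simp only [mem_inter_iff, mem_compl_iff, openConn, mem_setOf_eq]
    constructor
    · rintro ⟨⟨⟨hoa, hos⟩, hob⟩, hab⟩
      exact ⟨⟨⟨hoa, hos.symm.trans hoa⟩, hoa.symm.trans hob⟩, fun h12 => hab (h12.trans (hoa.symm.trans hob))⟩
    · rintro ⟨⟨⟨hoa, hsa⟩, hab⟩, h12⟩
      exact ⟨⟨⟨hoa, hoa.trans hsa.symm⟩, hoa.trans hab⟩, fun h1b => h12 (h1b.trans hab.symm)⟩
  rw [e1, e2]; exact key

/-- **Minor-monotonicity row (MM_s) at k = 2**: for the worse relay `a₁` and any vertex `s`,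
`μ({a₁↔b}∩{s↔o}∩{s↮b}∩{o↔a₂}) ≤ μ({s↔b}∩{a₁↮b}∩{a₁↮o})` — the pivotal form of "contracting `s` into the worst relay does not
increase the two-relay event-gluing slack".  From `localisedWorstRelayGluing_two` by monotonicity. [this file] -/
theorem minorMonotonicity_two (w : Sym2 V → unitInterval) (a₁ a₂ b o s : V)
    (h : (prodBernoulli w).real (openConn a₁ b) ≤ (prodBernoulli w).real (openConn a₂ b)) :
    (prodBernoulli w).real (openConn a₁ b ∩ openConn s o ∩ (openConn s b)ᶜ ∩ openConn o a₂) ≤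
      (prodBernoulli w).real (openConn s b ∩ (openConn a₁ b)ᶜ ∩ (openConn a₁ o)ᶜ) := by
  have key := localisedWorstRelayGluing_two w a₁ a₂ b o s h
  refine le_trans (le_of_eq ?_) (le_trans key (measureReal_mono ?_))
  · congr 1
    ext ω
    simp only [mem_inter_iff, mem_compl_iff, openConn, mem_setOf_eq]
    constructor
    · rintro ⟨⟨⟨hab, hso⟩, hsb⟩, hoa⟩
      exact ⟨⟨⟨hoa, hso.symm⟩, fun hob => hsb (hso.trans hob)⟩, hab⟩
    · rintro ⟨⟨⟨hoa, hos⟩, hob⟩, hab⟩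
      exact ⟨⟨⟨hab, hos.symm⟩, fun hsb => hob (hos.trans hsb)⟩, hoa⟩
  · rintro ω ⟨⟨⟨_, hos⟩, hob⟩, hab⟩
    simp only [mem_inter_iff, mem_compl_iff, openConn, mem_setOf_eq] at *
    exact ⟨⟨hos.symm.trans hob, hab⟩, fun hao => hab (hao.trans hob)⟩

end Summit.CriticalPhenomena.PercolationContinuityZ3.Theorems

end
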